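import Mathlib
import HarnessLib
import Literature.Probability.Percolation.Percolation
import Literature.Probability.Percolation.PercolationProofs
import Literature.Probability.Percolation.TwoPointFunction
import Summits.CriticalPhenomena.PercolationContinuityZ3.Theses.PercTreeValue
import Summits.CriticalPhenomena.PercolationContinuityZ3.Theorems.PercTreeValueTetrahedronLogConvexityCertDefs
import Summits.CriticalPhenomena.PercolationContinuityZ3.Theorems.PercTreeValueTetrahedronLogConvexityReflection
import Summits.CriticalPhenomena.PercolationContinuityZ3.Theorems.PercTreeValueTetrahedronLogConvexityStopping
import Summits.CriticalPhenomena.PercolationContinuityZ3.Theorems.PercTreeValueTetrahedronLogConvexityStrongMarkov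
import Summits.CriticalPhenomena.PercolationContinuityZ3.Theorems.PercTreeValueTetrahedronLogConvexityContR
import Summits.CriticalPhenomena.PercolationContinuityZ3.Theorems.PercTreeValueTetrahedronLogConvexityMirrorCS
import Summits.CriticalPhenomena.PercolationContinuityZ3.Theorems.PercTreeValueTetrahedronLogConvexityTransfer
import Summits.CriticalPhenomena.PercolationContinuityZ3.Theorems.PercTreeValueTetrahedronLogConvexityCertStrength

/-!
# Skeleton — crux `TetrahedronLogConvexity` (stmt-CriticalPhenomena-7801), line `Sketch`
# (card `mirror-certificate-vigour`, CERTIFICATE form = the card's main line; reshaped by the lead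
# after the web/slab form of the sketch died numerically, see `Negative-notes/web-slab-form-dead.md`)

Geometry: `T_r = {0, a_r, b_r, c_r}`, `a_r = (r,r,0)`, `b_r = (r,0,r)`, `c_r = (0,r,r)`; the lattice
reflection `θ(x₀,x₁,x₂) = (x₁,x₀,x₂)` fixes `0, a_r` and swaps `b_r ↔ c_r`.

Certificate: the layer-synchronous two-seed exploration of the open clusters of `0` and `a_r`,
stopped at the merge layer `N(ω) = ⌈d_ω(0,a_r)/2⌉` and truncated at `R` layers
(`NR r R ω = min(N(ω), R)`); its examined edges `explored r R ω` (all lattice edges incident to a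
vertex at open-graph distance `< NR` from `0` or from `a_r`) form a FINITE STOPPING SET
(`stub_stopping`), and `AR r R = {NR < R} = {d_ω(0,a_r) ≤ 2R-2} ↑ {0 ↔ a_r}` as `R → ∞`
(`stub_contR`).  The hybrid configuration `hyb r R (ω, ω') = (ω ∩ explored ω) ∪ (ω' \ explored ω)`
("keep the certificate, refresh the continuation") has the law of `ω` jointly with the data
(`stub_strongMarkov` (i)), and two INDEPENDENT continuations under-count the joint capture of
`b_r, c_r` by Harris (`stub_strongMarkov` (ii)).  With
`Qb = P⊗P{A_R(ω), 0↔b in hyb(ω,ω')}`, `Qbc = P⊗P⊗P{A_R(ω), 0↔b in hyb(ω,ω'), 0↔c in hyb(ω,ω'')}`,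
`Qbb` (b twice), the crux-level certificate `stub_certificate` is (V) `2(1+v)Qb² ≤ τ(Qbc+Qbb)`
(vigour: the launching power of the pinned certificate is not self-averaging) and (L)
`Qbb ≤ (1+η)Qbc` (lopsidedness) with `η < 2v`; the composition gives the crux with
`1+δ = 2(1+v)/(2+η)` after `R → ∞` and the mirror symmetry `P(0a,0c) = P(0a,0b)` (`stub_reflection`).
Ideator MC (canonical certificate, L=24): `(1-ρ²)(1+v) = 2(1+v)/(2+η) = 1.08±0.02 (r=4), 1.05±0.03 (r=6)`.
-/

noncomputable section

open MeasureTheory Filter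
open Literature.Probability.Percolation Literature.Probability.LatticeModels

namespace Summit.CriticalPhenomena.PercolationContinuityZ3.Theorems.TetrahedronLogConvexity.Cert

/-! ## Objects: landed as `Theorems/PercTreeValueTetrahedronLogConvexityCertDefs.lean` (p102817):
`vA vB vC Pc latOpen NR AR edgeWindow explored hyb Qb Qbc Qbb`. -/

/-! ## Stubs -/

/-- CRUX-LEVEL STUB (the crux transferred; card `mirror-certificate-vigour`, certificate form):
(V) vigour `2(1+v)·Qb² ≤ τ(0,a)·(Qbc + Qbb)` and (L) lopsidedness `Qbb ≤ (1+η)·Qbc`, eventually in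
`r` and then in the truncation `R`, with `η < 2v`. -/
theorem stub_certificate :
    ∃ v η : ℝ, 0 ≤ η ∧ η < 2 * v ∧ ∃ r₀ : ℕ, ∀ r : ℕ, r₀ ≤ r → ∃ R₀ : ℕ, ∀ R : ℕ, R₀ ≤ R →
      2 * (1 + v) * Qb r R ^ 2 ≤ tau 3 (criticalProbI 3) 0 (vA r) * (Qbc r R + Qbb r R) ∧
      Qbb r R ≤ (1 + η) * Qbc r R := by
  sorry

-- stub_reflection: LANDED (p104658, Theorems/PercTreeValueTetrahedronLogConvexityReflection.lean); imported above.


-- stub_stopping: LANDED (p106571, Theorems/PercTreeValueTetrahedronLogConvexityStopping.lean); imported above.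


-- stub_strongMarkov: LANDED (p107318, Theorems/PercTreeValueTetrahedronLogConvexityStrongMarkov.lean); imported above.


-- stub_contR: LANDED (p107665, Theorems/PercTreeValueTetrahedronLogConvexityContR.lean); imported above.


-- stub_mirrorCS: LANDED (p108981 Part1 + p110502, Theorems/PercTreeValueTetrahedronLogConvexityMirrorCS{Part1,}.lean); imported above.
-- transfer theorems tetrahedronLogConvexity_of_certHarrisGap / _of_certificate: LANDED (p111906, …Transfer.lean).
-- strength theorems (lead c1): percolationContinuityZ3_of_certHarrisGap / _of_certificate (stub ⇒ conjunct) and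
--   not_certHarrisGap_of_theta_ne_zero / not_certificate_of_theta_ne_zero (jump ⇒ ¬stub): LANDED (p135161, …CertStrength.lean).
--   Assessment of the open stub (conjunct-sized; LongRangeDiscontinuity bites below it): Lines/Sketch-c1-assessment.md.



/-- Consequence (support, not used by the composition): the vigour inequality of `stub_certificate` holds
with `v = 0` — the certificate sandwich is saturated exactly at the jump value, so the content of (V) is the
strict `v > 0`. -/
theorem vigour_at_zero (r R : ℕ) :
    2 * (1 + 0) * Qb r R ^ 2 ≤ tau 3 (criticalProbI 3) 0 (vA r) * (Qbc r R + Qbb r R) := by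
  have h := stub_mirrorCS r R
  have hA : Pc.real (AR r R) ≤ tau 3 (criticalProbI 3) 0 (vA r) := by
    rw [tau_def]
    exact measureReal_mono ((stub_contR r).1 R)
  have h0 : 0 ≤ Qbc r R + Qbb r R := add_nonneg measureReal_nonneg measureReal_nonneg
  calc 2 * (1 + 0) * Qb r R ^ 2 = 2 * Qb r R ^ 2 := by ring
    _ ≤ Pc.real (AR r R) * (Qbc r R + Qbb r R) := h
    _ ≤ tau 3 (criticalProbI 3) 0 (vA r) * (Qbc r R + Qbb r R) := mul_le_mul_of_nonneg_right hA h0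

/-! ## Composition -/

/-- Measurability of `{x ↔ y}` on the countable vertex set `ℤ³` (tree fact, restated for the glue). -/
theorem measurableSet_openConn₃ (x y : Site 3) : MeasurableSet (openConn x y : Set (BondConfig (Site 3))) :=
  measurableSet_openConn_holds x y

/-- The line closes the crux: (V) ∧ (L) with `η < 2v`, strong Markov + Harris, truncation removal and
the mirror symmetry give `TetrahedronLogConvexity` with `1 + δ = 2(1+v)/(2+η)`. -/
theorem TetrahedronLogConvexity_of :
    Summit.CriticalPhenomena.PercolationContinuityZ3.Theses.PercTreeValue.TetrahedronLogConvexity := by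
  unfold Summit.CriticalPhenomena.PercolationContinuityZ3.Theses.PercTreeValue.TetrahedronLogConvexity
  obtain ⟨v, η, hη, hηv, r₀, hcert⟩ := stub_certificate
  set κ : ℝ := 2 * (1 + v) / (2 + η) with hκ
  have h2η : 0 < 2 + η := by linarith
  have hκ1 : 1 < κ := by rw [hκ, lt_div_iff₀ h2η]; linarith
  refine ⟨κ - 1, by linarith, r₀, fun r hr => ?_⟩
  obtain ⟨R₀, hR⟩ := hcert r hr
  -- abbreviations
  set t3 := Pc.real (openConn 0 (vA r) ∩ openConn 0 (vB r)) with ht3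
  set t4 := Pc.real (openConn 0 (vA r) ∩ openConn 0 (vB r) ∩ openConn 0 (vC r)) with ht4
  set τ := tau 3 (criticalProbI 3) 0 (vA r) with hτ
  have h0τ : 0 ≤ τ := tau_nonneg _ _ _
  have h0t4 : 0 ≤ t4 := measureReal_nonneg
  -- for every R ≥ R₀:  κ · P(A_R, 0↔b)² ≤ τ · t4
  have hfin : ∀ R : ℕ, R₀ ≤ R → κ * Pc.real (AR r R ∩ openConn 0 (vB r)) ^ 2 ≤ τ * t4 := by
    intro R hRR
    obtain ⟨hV, hL⟩ := hR R hRR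
    obtain ⟨hmarg, hharris⟩ := stub_strongMarkov r R (stub_stopping r R)
    have hQb : Qb r R = Pc.real (AR r R ∩ openConn 0 (vB r)) :=
      hmarg (openConn 0 (vB r)) (measurableSet_openConn₃ 0 (vB r))
    have hsub : AR r R ∩ openConn 0 (vB r) ∩ openConn 0 (vC r) ⊆
        openConn 0 (vA r) ∩ openConn 0 (vB r) ∩ openConn 0 (vC r) := by
      intro ω hω
      exact ⟨⟨(stub_contR r).1 R hω.1.1, hω.1.2⟩, hω.2⟩
    have hQbc : Qbc r R ≤ t4 := hharris.trans (measureReal_mono hsub)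
    have h0bc : 0 ≤ Qbc r R := measureReal_nonneg
    have h0bb : 0 ≤ Qbb r R := measureReal_nonneg
    have hVL : 2 * (1 + v) * Qb r R ^ 2 ≤ (2 + η) * (τ * Qbc r R) := by
      calc 2 * (1 + v) * Qb r R ^ 2 ≤ τ * (Qbc r R + Qbb r R) := hV
        _ ≤ τ * (Qbc r R + (1 + η) * Qbc r R) := by gcongr
        _ = (2 + η) * (τ * Qbc r R) := by ring
    have hVL' : κ * Qb r R ^ 2 ≤ τ * Qbc r R := by
      rw [hκ, div_mul_eq_mul_div, div_le_iff₀ h2η]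
      linarith
    rw [← hQb]
    exact hVL'.trans (mul_le_mul_of_nonneg_left hQbc h0τ)
  -- pass to the limit R → ∞
  have hlim : Tendsto (fun R : ℕ => κ * Pc.real (AR r R ∩ openConn 0 (vB r)) ^ 2) atTop
      (nhds (κ * t3 ^ 2)) := ((stub_contR r).2.pow 2).const_mul κ
  have hle : κ * t3 ^ 2 ≤ τ * t4 :=
    le_of_tendsto hlim (Filter.eventually_atTop.2 ⟨R₀, hfin⟩)
  -- mirror symmetry and bookkeeping
  have hsym : Pc.real (openConn 0 ![(r : ℤ), (r : ℤ), 0] ∩ openConn 0 ![0, (r : ℤ), (r : ℤ)]) = t3 :=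
    stub_reflection r
  have ht3' : Pc.real (openConn 0 ![(r : ℤ), (r : ℤ), 0] ∩ openConn 0 ![(r : ℤ), 0, (r : ℤ)]) = t3 := rfl
  have ht4' : Pc.real (openConn 0 ![(r : ℤ), (r : ℤ), 0] ∩ openConn 0 ![(r : ℤ), 0, (r : ℤ)] ∩
      openConn 0 ![0, (r : ℤ), (r : ℤ)]) = t4 := rfl
  have hτ' : tau 3 (criticalProbI 3) 0 ![(r : ℤ), (r : ℤ), 0] = τ := rfl
  change (1 + (κ - 1)) * Pc.real (openConn 0 ![(r : ℤ), (r : ℤ), 0] ∩ openConn 0 ![(r : ℤ), 0, (r : ℤ)]) *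
      Pc.real (openConn 0 ![(r : ℤ), (r : ℤ), 0] ∩ openConn 0 ![0, (r : ℤ), (r : ℤ)]) ≤
    Pc.real (openConn 0 ![(r : ℤ), (r : ℤ), 0] ∩ openConn 0 ![(r : ℤ), 0, (r : ℤ)] ∩
      openConn 0 ![0, (r : ℤ), (r : ℤ)]) * tau 3 (criticalProbI 3) 0 ![(r : ℤ), (r : ℤ), 0]
  rw [hsym, ht3', ht4', hτ']
  calc (1 + (κ - 1)) * t3 * t3 = κ * t3 ^ 2 := by ring
    _ ≤ τ * t4 := hle
    _ = t4 * τ := by ring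

end Summit.CriticalPhenomena.PercolationContinuityZ3.Theorems.TetrahedronLogConvexity.Cert
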